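import Summits.AtomisticToContinuum.HydrodynamicLimit.Theorems.BoltzmannGreenKubo.Negative.EnergyFloor
import Literature.Analysis.FluidPDE.HardSphereAlexander
import Literature.Analysis.UnboundedOperators.LinearizedBoltzmannProofs

/-!
# `BoltzmannGreenKubo` needs orthogonality to the KINETIC ENERGY (`g ⊥ |v|²` is load-bearing on its own)

Negative knowledge for the crux `AntiMazurCoboundaries.BoltzmannGreenKubo` (stmt-AtomisticToContinuum-13985), from the
standing disprover's `Cruxes/BoltzmannGreenKubo/Disproof.lean` §1i (gen 1, v8; landed by gen 2): `BoltzmannGreenKuboWithoutOrthEnergy`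
is the crux VERBATIM with the clause weakened to `g ⊥ span(1, v)` (orthogonality to `|v|²` dropped), and it is FALSE
(`boltzmannGreenKubo_false_without_orthEnergy`): witness `φ ≡ 1`, `g = g_E` (even, centred, bounded; energy overlap `m_E ≥ 1`),
and the mechanised ENERGY FLOOR `energy_floor` of `Negative/EnergyFloor` (Mazur against `Q = 2E − 3(N+1)`): the window functional
per particle is `≥ κ_E > 0` for every `N`, `σ ≤ 1/2`, window, so `s·κ_E ≤ 2D + 1` fails for `s` large. Together with
`Negative/Orthogonality` (`⊥ 1`) and `Negative/OrthMomentum` (`⊥ v`): all THREE parts of the clause are independently necessary.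
refuter-cdisprove-stmt-AtomisticToContinuum-13985-0 (proof), refuter-cdisprove-stmt-AtomisticToContinuum-13985-g2-0 (landing).
-/

noncomputable section

namespace Summit.AtomisticToContinuum.HydrodynamicLimit.Theorems

open MeasureTheory ProbabilityTheory Filter Topology Set
open Literature.Analysis.FluidPDE Literature.MathematicalPhysics.KineticTheory
open Literature.Analysis.UnboundedOperators
open scoped InnerProductSpace
open BoltzmannGreenKuboForallN BoltzmannGreenKuboOrthMomentum

/-- `BoltzmannGreenKubo` with the orthogonality clause WEAKENED to `g ⊥ span(1, v)` only (orthogonality to `|v|²`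
dropped; everything else verbatim). -/
def BoltzmannGreenKuboWithoutOrthEnergy : Prop :=
  ∀ (a θ : ℝ) (u₀ : Literature.MathematicalPhysics.KineticTheory.V3), 0 < a → 0 < θ → ∀ (φ : Literature.MathematicalPhysics.KineticTheory.T3 → ℝ) (g : Literature.MathematicalPhysics.KineticTheory.V3 → ℝ), Continuous φ → Continuous g → (∀ x, |φ x| ≤ 1) → (∃ K : ℝ, ∀ v, |g v| ≤ K) → (∀ (c₀ : ℝ) (b : Literature.MathematicalPhysics.KineticTheory.V3), ∫ v, g v * (c₀ + inner ℝ b v) ∂(ProbabilityTheory.stdGaussian Literature.MathematicalPhysics.KineticTheory.V3) = 0) → ∀ η : ℝ, 0 < η → ∃ s₀ : ℝ, 0 < s₀ ∧ ∀ s : ℝ, s₀ ≤ s → ∃ σ₀ : ℝ, 0 < σ₀ ∧ ∀ σ : ℝ, 0 < σ → σ < σ₀ → (∀ (N : ℕ) (Φ : Literature.Analysis.FluidPDE.HardSphereFlow (Literature.Analysis.FluidPDE.Torus.geometry (Fin 3)) (Literature.MathematicalPhysics.KineticTheory.hsDiameter σ N) (N + 1)), MeasureTheory.IsProbabilityMeasure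 (Literature.MathematicalPhysics.KineticTheory.localGibbsLaw σ (fun _ => a) (fun _ => u₀) (fun _ => θ) N Φ)) ∧ ∃ N₀ : ℕ, ∀ N : ℕ, N₀ ≤ N → ∀ Φ : Literature.Analysis.FluidPDE.HardSphereFlow (Literature.Analysis.FluidPDE.Torus.geometry (Fin 3)) (Literature.MathematicalPhysics.KineticTheory.hsDiameter σ N) (N + 1), (let h : ℝ := s / (σ ^ 2 * Real.sqrt θ) * ((N + 1 : ℕ) : ℝ) ^ (-(1 / 3 : ℝ)); |s * ((∫⁻ z, ENNReal.ofReal ((h⁻¹ * ∫ r in (0 : ℝ)..h, ∑ i, φ (Φ.flow r z i).1 * g ((Real.sqrt θ)⁻¹ • ((Φ.flow r z i).2 - u₀))) ^ 2) ∂(Literature.MathematicalPhysics.KineticTheory.localGibbsLaw σ (fun _ => a) (fun _ => u₀) (fun _ => θ) N Φ)).toReal / (((N : ℝ)) + 1)) - 2 * (∫ x, φ x ^ 2) * Literature.Analysis.UnboundedOperators.dirichletFormInv (Literature.Analysis.UnboundedOperators.hardSphereLinearizedOp (E := Literature.MathematicalPhysics.KineticTheory.V3)) g| ≤ η)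

/-- **ANY PROOF MUST USE ORTHOGONALITY TO THE KINETIC ENERGY** (the clause `g ⊥ |v|²` is load-bearing on its own):
with it dropped the statement is FALSE. Witness `φ ≡ 1`, `g = g_E` (even and centred, so `⊥ 1, v`, but with energy
overlap `m_E ≥ 1`): by the mechanised ENERGY FLOOR (`energy_floor`: stationarity + ENERGY conservation + joint
measurability + Fubini + a quadratic Cauchy–Schwarz against `Q = 2E − 3(N+1)`) the window functional per particle is
`≥ κ_E > 0` for EVERY `N`, `σ`, window, so `s·κ_E ≤ 2D + 1` fails at `s = max(s₀, (2D + 2)/κ_E)`. [folklore] -/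
theorem boltzmannGreenKubo_false_without_orthEnergy : ¬ BoltzmannGreenKuboWithoutOrthEnergy := by
  intro hyp
  set D := dirichletFormInv (hardSphereLinearizedOp (E := V3)) gE with hDdef
  have hD0 : 0 ≤ D := dirichletFormInv_nonneg _ _
  have hκ := kappaE_pos
  obtain ⟨s₀, hs₀, h2⟩ := hyp 1 1 0 one_pos one_pos (fun _ => 1) gE continuous_const continuous_gE
    (fun _ => by simp) ⟨1000, abs_gE_le⟩ gE_orth 1 one_pos
  set s : ℝ := max s₀ ((2 * D + 2) / kappaE) with hsdef
  have hs0 : s₀ ≤ s := le_max_left _ _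
  have hsK : (2 * D + 2) / kappaE ≤ s := le_max_right _ _
  have hspos : 0 < s := by linarith
  obtain ⟨σ₀, hσ₀, h3⟩ := h2 s hs0
  set σ : ℝ := min (σ₀ / 2) (1 / 4) with hσdef
  have hσpos : 0 < σ := lt_min (by linarith) (by norm_num)
  have hσlt : σ < σ₀ := lt_of_le_of_lt (min_le_left _ _) (by linarith)
  have hσle : σ ≤ 1 / 4 := min_le_right _ _
  have hσhalf : σ ≤ 1 / 2 := by linarith
  obtain ⟨hprob, N₀, h4⟩ := h3 σ hσpos hσlt
  have hεpos : 0 < hsDiameter σ N₀ := hsDiameter_pos hσpos N₀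
  have hεlt : hsDiameter σ N₀ < 2⁻¹ := by
    have := hsDiameter_le hσpos.le N₀
    linarith
  obtain ⟨Φ⟩ := HardSphereFlow.nonempty_torus_holds (d := Fin 3) hεpos hεlt (N₀ + 1)
  haveI := hprob N₀ Φ
  have k := h4 N₀ le_rfl Φ
  have hh : 0 < s / (σ ^ 2 * Real.sqrt 1) * ((N₀ + 1 : ℕ) : ℝ) ^ (-(1 / 3 : ℝ)) := by positivity
  dsimp only at k
  set hN : ℝ := s / (σ ^ 2 * Real.sqrt 1) * ((N₀ + 1 : ℕ) : ℝ) ^ (-(1 / 3 : ℝ)) with hhN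
  simp only [one_mul, Real.sqrt_one, inv_one, one_smul, sub_zero] at k
  have hint1 : ∫ x : T3, (1 : ℝ) ^ 2 = 1 := by simp
  rw [hint1, mul_one] at k
  have hfloor : ((N₀ : ℝ) + 1) * kappaE ≤ ∫ z, (hN⁻¹ * ∫ r in (0 : ℝ)..hN, ∑ i, gE ((Φ.flow r z i).2)) ^ 2
      ∂(localGibbsLaw σ (fun _ => 1) (fun _ => 0) (fun _ => 1) N₀ Φ) :=
    energy_floor (N := N₀) hσhalf Φ hh
  have hAm : AEStronglyMeasurable (fun z => (hN⁻¹ * ∫ r in (0 : ℝ)..hN, ∑ i, gE ((Φ.flow r z i).2)) ^ 2)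
      (localGibbsLaw σ (fun _ => 1) (fun _ => 0) (fun _ => 1) N₀ Φ) :=
    ((integrable_window 1 1 0 Φ measurable_FE (integrable_FE Φ) hh.le).aestronglyMeasurable.const_mul _).pow 2
  have hW : (∫⁻ z, ENNReal.ofReal ((hN⁻¹ * ∫ r in (0 : ℝ)..hN, ∑ i, gE ((Φ.flow r z i).2)) ^ 2)
      ∂(localGibbsLaw σ (fun _ => 1) (fun _ => 0) (fun _ => 1) N₀ Φ)).toReal =
      ∫ z, (hN⁻¹ * ∫ r in (0 : ℝ)..hN, ∑ i, gE ((Φ.flow r z i).2)) ^ 2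
        ∂(localGibbsLaw σ (fun _ => 1) (fun _ => 0) (fun _ => 1) N₀ Φ) := by
    rw [integral_eq_lintegral_of_nonneg_ae (Eventually.of_forall fun z => sq_nonneg _) hAm]
  rw [hW] at k
  have hWge : kappaE ≤ (∫ z, (hN⁻¹ * ∫ r in (0 : ℝ)..hN, ∑ i, gE ((Φ.flow r z i).2)) ^ 2
      ∂(localGibbsLaw σ (fun _ => 1) (fun _ => 0) (fun _ => 1) N₀ Φ)) / ((N₀ : ℝ) + 1) := by
    rw [le_div_iff₀ (by positivity)]
    linarith [hfloor]
  rw [← hDdef, abs_le] at k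
  have hmul : s * kappaE ≤ s * ((∫ z, (hN⁻¹ * ∫ r in (0 : ℝ)..hN, ∑ i, gE ((Φ.flow r z i).2)) ^ 2
      ∂(localGibbsLaw σ (fun _ => 1) (fun _ => 0) (fun _ => 1) N₀ Φ)) / ((N₀ : ℝ) + 1)) :=
    mul_le_mul_of_nonneg_left hWge hspos.le
  have hsk : 2 * D + 2 ≤ s * kappaE := by
    have := (div_le_iff₀ hκ).1 hsK
    linarith
  linarith [k.2, hmul, hsk]

end Summit.AtomisticToContinuum.HydrodynamicLimit.Theorems

end
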